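import Summits.QuantumFields.YangMills.Theorems.BalabanUVNodesN18LoopLipschitz
import Literature.MathematicalPhysics.QuantumFieldTheory.Balaban1983to89.BlockAveragingEMLAnalyticMean

/-!
# BalabanUVNodes ∕ node N18 = NE5 — closure-ledger item (iii), (β2) third brick: THE `exp[mean log]` CORRECTION OF THE (0.4) AVERAGE TO SECOND ORDER IS
# LIPSCHITZ IN THE CONFIGURATION — `κ_c(U) − 1 − |I|⁻¹Σᵢ(Wᵢ(U) − 1)` (bounded by `6θ²` in `BlockAveragingEMLProp2.norm_corr_sub_mean_le`) changes by at most
# `144·θ·sup_i‖Wᵢ(U) − Wᵢ(U′)‖ ≤ 144·θ·ℓ·sup_b‖U_b − U′_b‖` between two configurations whose loop variables are within `θ ≤ 1∕24` of `1` (mean value inequality on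
# the analytic mean `eml`) (Track A, DAG node N18 = `T4OutputRate.NE5` :211; cluster K4 «SpineRates», item K3⁷ `SpineGivenEndpointR13SepCoPH`; module 24 of seat
# pub-ymgap-dag-n18-d, strategy s2)

HONEST FRAMING.  Count-neutral kernel bookkeeping (`--supports stmt-QuantumFields-20544 --as helper`); elementary, PROVED from the tree's analytic-mean engine
(`BlockAveragingEMLAnalyticMean.norm_fderiv_eml_sub_mean_le`, `ExpMeanLog.differentiableAt_eml`, `BlockAveragingEMLProp2.coe_avg_eq_eml`) and Mathlib's mean value
inequality (`Convex.norm_image_sub_le_of_norm_fderiv_le`).  NE5 is NOT PRINTED and NOT proved; N18 is NOT discharged; this is link 3 of the C¹ remainder (β2) of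
the seat's `N18-BETA-SPEC.md`.

WHY.  See modules 22–23.  The C⁰ remainder of [Balaban1985Averaging] Prop 3 for the average of record decomposes as `(κ−1)(S−1) + (κ − 1 − M) + mean Eᵢ`
(`BlockAveragingEMLLinearised.norm_avgFun_sub_one_sub_linAvg_le`); modules 22–23 made the third and (the factors of) the first term Lipschitz in the configuration; this
file does the middle term: the correction factor `κ_c = exp[mean log](W)` is an ANALYTIC function of the loop family `W` near the identity family with derivative
`mean + O(‖W − 1‖)` (`norm_fderiv_eml_sub_mean_le`: `‖D eml(V)X − mean X‖ ≤ 144‖X‖‖V − 1‖`), so `W ↦ eml W − mean W` is `144θ`-Lipschitz on the ball `‖W − 1‖ ≤ θ ≤ 1∕24`.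

WHAT.  `norm_emlRem_sub_emlRem_le` (generic: complete normed `ℂ`-algebra `𝔸`, finite index type; `‖(eml W − 1 − mean(W−1)) − (eml W′ − 1 − mean(W′−1))‖ ≤
144·θ·‖W − W′‖` on the `θ`-ball, `θ ≤ 1∕24`), `norm_loopHol_sub_loopHol_le` (`‖Wᵢ(U) − Wᵢ(U′)‖ ≤ ℓ·ε`, loop words have `≤ ℓ = (d+2)L` steps), ★ `norm_corrRem_sub_corrRem_le`
(`SU(N)`, the (0.4) correction of record `corr expMeanLogSU`: `‖(κ(U) − 1 − M(U)) − (κ(U′) − 1 − M(U′))‖ ≤ 144·θ·ℓ·ε` when all loop variables of both configurations are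
within `θ` of `1`, `θ ≤ 1∕24`, `θ < δ_N`, and the configurations are within `ε` bondwise).
Next (spec §(β2), link 4): the assembly `‖R_c(U) − R_c(U′)‖ ≤ C·ℓ²·δ·ε` and the C¹ statement through `BlockAveraging.avgFun_translate`.

WHAT THIS IS NOT.  Not the C¹ remainder; not (β); finite tori — not continuum ∕ OS ∕ mass gap ∕ Clay.  0 `def`, 0 `sorry`, standard axioms.
-/

open scoped BigOperators

namespace YMDAG.N18.HolonomyLipschitz

open Literature.MathematicalPhysics.QuantumFieldTheory.Balaban1983to89
open Literature.MathematicalPhysics.QuantumFieldTheory.Balaban1983to89.T4Continuum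
open Literature.MathematicalPhysics.QuantumFieldTheory.Balaban1983to89.BlockAveraging
open Literature.MathematicalPhysics.QuantumFieldTheory.Balaban1983to89.B7TransferAnalyticMean (meanCLM meanCLM_apply)
open Literature.MathematicalPhysics.QuantumFieldTheory.Balaban1983to89.ExpMeanLog (eml deltaSU expMeanLogSU differentiableAt_eml)
open Literature.MathematicalPhysics.QuantumFieldTheory.Balaban1983to89.BlockAveragingEMLAnalyticMean (norm_fderiv_eml_sub_mean_le)
open Literature.MathematicalPhysics.QuantumFieldTheory.Balaban1983to89.LatticeWordStokes (length_loopWord_le)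
open Literature.MathematicalPhysics.QuantumFieldTheory.Balaban1983to89.BlockAveragingEMLLinearised (length_walk)

/-! ## §1 The analytic mean `eml` to second order is Lipschitz on the small ball -/

section Eml

variable {ι : Type*} [Fintype ι] {𝔸 : Type*} [NormedRing 𝔸] [NormedAlgebra ℂ 𝔸] [CompleteSpace 𝔸]

/-- **`W ↦ eml W − 1 − mean(W − 1)` IS `144θ`-LIPSCHITZ ON THE BALL `‖W − 1‖ ≤ θ ≤ 1∕24`** (sup norm on families): the mean value inequality for the analytic
map `W ↦ eml W − mean W`, whose derivative at `V` is `D eml(V) − mean` with `‖D eml(V) − mean‖ ≤ 144‖V − 1‖` (`BlockAveragingEMLAnalyticMean.norm_fderiv_eml_sub_mean_le`).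
[cite: Balaban1985Averaging, (26)-(27) p.22; Balaban1987RG1, (0.8) p.253] -/
theorem norm_emlRem_sub_emlRem_le {W W' : ι → 𝔸} {θ : ℝ} (hW : ‖W - 1‖ ≤ θ) (hW' : ‖W' - 1‖ ≤ θ) (hθ : θ ≤ 1 / 24) :
    ‖(eml W - 1 - meanCLM ι 𝔸 (W - 1)) - (eml W' - 1 - meanCLM ι 𝔸 (W' - 1))‖ ≤ 144 * θ * ‖W - W'‖ := by
  have hθ0 : 0 ≤ θ := (norm_nonneg _).trans hW
  -- the map and its derivative on the closed ball around the identity family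
  set f : (ι → 𝔸) → 𝔸 := fun V => eml V - meanCLM ι 𝔸 V with hf
  have hball : ∀ V ∈ Metric.closedBall (1 : ι → 𝔸) θ, ‖V - 1‖ ≤ θ := fun V hV => by rwa [Metric.mem_closedBall, dist_eq_norm] at hV
  have hdiffE : ∀ V ∈ Metric.closedBall (1 : ι → 𝔸) θ, DifferentiableAt ℂ (eml : (ι → 𝔸) → 𝔸) V := by
    intro V hV
    refine differentiableAt_eml fun i => ?_
    calc ‖V i - 1‖ = ‖(V - 1) i‖ := by simp
      _ ≤ ‖V - 1‖ := norm_le_pi_norm (V - 1) i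
      _ < 1 := (hball V hV).trans_lt (hθ.trans_lt (by norm_num))
  have hdiff : ∀ V ∈ Metric.closedBall (1 : ι → 𝔸) θ, DifferentiableAt ℂ f V :=
    fun V hV => (hdiffE V hV).sub (meanCLM ι 𝔸).differentiableAt
  have hbound : ∀ V ∈ Metric.closedBall (1 : ι → 𝔸) θ, ‖fderiv ℂ f V‖ ≤ 144 * θ := by
    intro V hVm
    have hV := hball V hVm
    have hder : fderiv ℂ f V = fderiv ℂ (eml : (ι → 𝔸) → 𝔸) V - meanCLM ι 𝔸 := by
      rw [hf, fderiv_fun_sub (hdiffE V hVm) (meanCLM ι 𝔸).differentiableAt, ContinuousLinearMap.fderiv]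
    rw [hder]
    refine ContinuousLinearMap.opNorm_le_bound _ (by positivity) fun X => ?_
    change ‖fderiv ℂ (eml : (ι → 𝔸) → 𝔸) V X - meanCLM ι 𝔸 X‖ ≤ _
    calc ‖fderiv ℂ (eml : (ι → 𝔸) → 𝔸) V X - meanCLM ι 𝔸 X‖ ≤ 144 * ‖X‖ * ‖V - 1‖ := norm_fderiv_eml_sub_mean_le (hV.trans hθ) X
      _ ≤ 144 * ‖X‖ * θ := by gcongr
      _ = 144 * θ * ‖X‖ := by ring
  have hconv : Convex ℝ (Metric.closedBall (1 : ι → 𝔸) θ) := convex_closedBall _ _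
  have hWm : W ∈ Metric.closedBall (1 : ι → 𝔸) θ := by rw [Metric.mem_closedBall, dist_eq_norm]; exact hW
  have hW'm : W' ∈ Metric.closedBall (1 : ι → 𝔸) θ := by rw [Metric.mem_closedBall, dist_eq_norm]; exact hW'
  have hmv := hconv.norm_image_sub_le_of_norm_fderiv_le hdiff hbound hW'm hWm
  -- `f W − f W′` is the difference of the two second-order remainders (the means are linear)
  have e : (eml W - 1 - meanCLM ι 𝔸 (W - 1)) - (eml W' - 1 - meanCLM ι 𝔸 (W' - 1)) = f W - f W' := by
    simp only [hf, map_sub]; abel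
  rw [e]
  exact hmv

end Eml

/-! ## §2 The (0.4) correction of record on `SU(N)` -/

section Corr

open scoped Matrix.Norms.L2Operator

variable {n : Type*} [Fintype n] [DecidableEq n] [Nonempty n] {P : Params} {j : ℕ}

/-- **The loop variables are `ℓ`-Lipschitz in the configuration**: the loop words of (0.4) have at most `ℓ = (d+2)L` steps
(`LatticeWordStokes.length_loopWord_le`), so `‖Wᵢ(U) − Wᵢ(U′)‖ ≤ ℓ·ε` for configurations within `ε` bondwise (module 23 `norm_holAt_sub_holAt_le_of_forall`).
[cite: Balaban1987RG1, (0.3)-(0.4) pp.252-253] -/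
theorem norm_loopHol_sub_loopHol_le (U U' : GaugeField P j (Matrix.specialUnitaryGroup n ℂ)) {ε : ℝ} (hε : 0 ≤ ε)
    (hUU' : ∀ b, ‖((U b : Matrix.specialUnitaryGroup n ℂ) : Matrix n n ℂ) - ((U' b : Matrix.specialUnitaryGroup n ℂ) : Matrix n n ℂ)‖ ≤ ε)
    (c : PBond P (j + 1)) (i : Idx P) :
    ‖((loopHol U c i : Matrix.specialUnitaryGroup n ℂ) : Matrix n n ℂ) - ((loopHol U' c i : Matrix.specialUnitaryGroup n ℂ) : Matrix n n ℂ)‖ ≤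
      ((((P.d + 2) * P.L : ℕ) : ℝ)) * ε := by
  unfold loopHol
  have hlen : ((walk (emb c.src) (loopWord P.L c.dir (off i.1) i.2.1 i.2.2)).length : ℝ) ≤ (((P.d + 2) * P.L : ℕ) : ℝ) := by
    exact_mod_cast (length_walk _ _).le.trans (length_loopWord_le c i)
  exact (norm_holAt_sub_holAt_le_of_forall U U' _ fun s _ => hUU' s.bond).trans (mul_le_mul_of_nonneg_right hlen hε)

/-- ★ **THE (0.4) CORRECTION FACTOR TO SECOND ORDER IS LIPSCHITZ IN THE CONFIGURATION.**  For the averaging of record (`corr expMeanLogSU`, `SU(N)`): if all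
loop variables `Wᵢ(U)`, `Wᵢ(U′)` at the coarse bond `c` are within `θ` of `1` with `θ ≤ 1∕24` and `θ < δ_N` (the guard of `exp[mean log]`), and the configurations are
within `ε` bondwise, then with `M(U) = |I|⁻¹Σᵢ(Wᵢ(U) − 1)`:
`‖(κ_c(U) − 1 − M(U)) − (κ_c(U′) − 1 − M(U′))‖ ≤ 144·θ·ℓ·ε` (`ℓ = (d+2)L`).  The C⁰ companion is `BlockAveragingEMLProp2.norm_corr_sub_mean_le` (`6θ²`).
[cite: Balaban1987RG1, (0.4) and (0.8) p.253; Balaban1985Averaging, Prop. 3 (123) p.36] -/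
theorem norm_corrRem_sub_corrRem_le (U U' : GaugeField P j (Matrix.specialUnitaryGroup n ℂ)) (c : PBond P (j + 1)) {θ ε : ℝ}
    (hθ : ∀ i, dist1 (loopHol U c i) ≤ θ) (hθ' : ∀ i, dist1 (loopHol U' c i) ≤ θ) (hθδ : θ < deltaSU n) (hθ24 : θ ≤ 1 / 24) (hε : 0 ≤ ε)
    (hUU' : ∀ b, ‖((U b : Matrix.specialUnitaryGroup n ℂ) : Matrix n n ℂ) - ((U' b : Matrix.specialUnitaryGroup n ℂ) : Matrix n n ℂ)‖ ≤ ε) :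
    ‖(((corr (expMeanLogSU (n := n)) U c : Matrix.specialUnitaryGroup n ℂ) : Matrix n n ℂ) - 1 -
          ((Fintype.card (Idx P) : ℂ))⁻¹ • ∑ i, (((loopHol U c i : Matrix.specialUnitaryGroup n ℂ) : Matrix n n ℂ) - 1)) -
        (((corr (expMeanLogSU (n := n)) U' c : Matrix.specialUnitaryGroup n ℂ) : Matrix n n ℂ) - 1 -
          ((Fintype.card (Idx P) : ℂ))⁻¹ • ∑ i, (((loopHol U' c i : Matrix.specialUnitaryGroup n ℂ) : Matrix n n ℂ) - 1))‖ ≤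
      144 * θ * (((((P.d + 2) * P.L : ℕ) : ℝ)) * ε) := by
  have hθ0 : 0 ≤ θ := (GaugeGroup.dist1_nonneg _).trans (hθ (Classical.arbitrary _))
  have hsmall : Small (expMeanLogSU (n := n)) U c := fun i => (hθ i).trans_lt hθδ
  have hsmall' : Small (expMeanLogSU (n := n)) U' c := fun i => (hθ' i).trans_lt hθδ
  unfold corr
  rw [if_pos hsmall, if_pos hsmall', BlockAveragingEMLProp2.coe_avg_eq_eml _ hsmall, BlockAveragingEMLProp2.coe_avg_eq_eml _ hsmall']
  set W : Idx P → Matrix n n ℂ := fun i => ((loopHol U c i : Matrix.specialUnitaryGroup n ℂ) : Matrix n n ℂ) with hWd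
  set W' : Idx P → Matrix n n ℂ := fun i => ((loopHol U' c i : Matrix.specialUnitaryGroup n ℂ) : Matrix n n ℂ) with hW'd
  -- the families in sup norm
  have hWball : ‖W - 1‖ ≤ θ := (pi_norm_le_iff_of_nonneg hθ0).2 fun i => by
    simpa [hWd, FederbushMean.dist1_SU_eq] using hθ i
  have hW'ball : ‖W' - 1‖ ≤ θ := (pi_norm_le_iff_of_nonneg hθ0).2 fun i => by
    simpa [hW'd, FederbushMean.dist1_SU_eq] using hθ' i
  have hℓε : 0 ≤ (((((P.d + 2) * P.L : ℕ) : ℝ)) * ε) := by positivity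
  have hWW' : ‖W - W'‖ ≤ ((((P.d + 2) * P.L : ℕ) : ℝ)) * ε := (pi_norm_le_iff_of_nonneg hℓε).2 fun i => by
    simpa [hWd, hW'd] using norm_loopHol_sub_loopHol_le U U' hε hUU' c i
  -- the means in `meanCLM` form
  have hmean : ∀ V : Idx P → Matrix n n ℂ, ((Fintype.card (Idx P) : ℂ))⁻¹ • ∑ i, (V i - 1) = meanCLM (Idx P) (Matrix n n ℂ) (V - 1) := fun V => by
    rw [meanCLM_apply]; rfl
  rw [hmean W, hmean W']
  calc ‖(eml W - 1 - meanCLM (Idx P) (Matrix n n ℂ) (W - 1)) - (eml W' - 1 - meanCLM (Idx P) (Matrix n n ℂ) (W' - 1))‖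
      ≤ 144 * θ * ‖W - W'‖ := norm_emlRem_sub_emlRem_le hWball hW'ball hθ24
    _ ≤ 144 * θ * (((((P.d + 2) * P.L : ℕ) : ℝ)) * ε) := by gcongr

end Corr

end YMDAG.N18.HolonomyLipschitz
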